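import Summits.QuantumFields.YangMills.Theorems.LangevinControlUVFemtoCurvatureTwoPointCReduction
import Summits.QuantumFields.YangMills.Theorems.LangevinControlUVFemtoCurvatureTwoPointCStubTwoLoopAdmissible
import Summits.QuantumFields.YangMills.Theorems.LangevinControlUVFemtoCurvatureTwoPointCStubTwoLoopStepLaw
import Summits.QuantumFields.YangMills.Theorems.LangevinControlUVFemtoCurvatureTwoPointRateFree

/-!
# Route `LangevinControlUV`, crux `FemtoCurvatureTwoPointC` (stmt-QuantumFields-16204), line `Sketch` — cycle-2 reduction:
# `AsymptoticScalingAt r → AFCouplingAt r → CruxCAt r`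

Lead `prover-line-stmt-QuantumFields-16204-0`. The explicit two-loop asymptotic-freedom coupling `twoLoopCoupling κ c₀ b₀ q`
(`…CDefs`, cycle-2 vocabulary) IS an AF coupling in the sense of `AFCouplingAt`: admissibility is the landed calculus stub
`stub_twoLoopAdmissible` (`…CStubTwoLoopAdmissible`, p124718), in-window comparability and the two-sided dyadic step law
(`κ₁ = 2b₀ log 2`, `κ₃ = 0`) the landed calculus stub `stub_twoLoopStepLaw` (`…CStubTwoLoopStepLaw`, p124768), and the
matchings are exactly the physics statement `AsymptoticScalingAt r`. Composed with the cycle-1 reduction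
`cruxCAt_of_afCouplingAt` / `femtoCurvatureTwoPointC_of_afCoupling` (`…CReduction`, p123348) this proves

  `AsymptoticScaling → FemtoCurvatureTwoPointC`   (`femtoCurvatureTwoPointC_of_asymptoticScaling`),

so the crux closes the moment the registered stub `stub_asymptoticScaling` (= `AsymptoticScaling`, `asymptoticScaling_iff_stub`)
lands. Two further sections make the physics statement transparent for whoever proves or attacks it:

* ULTRAVIOLET COROLLARY: `shapeFree_of_asymptoticScalingAt` — `AsymptoticScalingAt r` implies the eventual shape-free
  bounds `H` of the predecessor crux's rate-free reduction `FemtoCurvatureTwoPoint.RateFree.cruxAt_of_shapeFree`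
  (stmt-QuantumFields-9363: positivity, cross-torus comparability, pair domination on tori of bounded size — its open stubs),
  since every bounded family of boxes is eventually inside the two-loop window; hence
  `femtoCurvatureTwoPoint_cruxAt_of_asymptoticScalingAt`. ONE physics statement serves both cruxes.
* WINDOW = FEMTO CONDITION: the coupling grows with the box (`twoLoopCoupling_mono`), so the window hypothesis is
  `u(L,β) ≤ u₀` (`twoLoop_window_iff`); there is a threshold `T₀ > 2b₀ log 2` with `ψ_q(T₀) = 1/u₀`
  (`exists_windowThreshold`), and `u(L,β) ≤ u₀ ↔ T₀ ≤ T(L,β) ↔ L ≤ 8·exp((Y(β) − T₀)/(2b₀))`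
  (`twoLoop_top_iff`, `twoLoopT_ge_iff`, `twoLoop_window_iff_femto`): the window is `L ≤ ℓ·a₂ₗₒₒₚ(β)⁻¹`.

Nothing is asserted here; no `sorry`.
-/

set_option autoImplicit false

noncomputable section

open Filter Topology MeasureTheory
open Literature.MathematicalPhysics.QuantumFieldTheory

namespace Summit.QuantumFields.YangMills.Theorems.FemtoCurvatureTwoPointC

/-- **The explicit two-loop coupling is an AF coupling**: `AsymptoticScalingAt r → AFCouplingAt r`. The window hypotheses
of `AFCouplingAt` ("every sub-box `8 ≤ M ≤ L` has `u M β ≤ u₀`") are used only at the top box, where the calculus stubs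
need them; `κ₃ = 0`. -/
theorem afCouplingAt_of_asymptoticScalingAt {G : Type} [Group G] [TopologicalSpace G] [IsTopologicalGroup G]
    [CompactSpace G] [MeasurableSpace G] [BorelSpace G] (r : LatticeRep G) (h : AsymptoticScalingAt r) :
    AFCouplingAt r := by
  obtain ⟨κ, c₀, b₀, q, u₀, β₀, c, C, hκ, hb₀, hq, hu₀, hu₀ψ, hc, hphys⟩ := h
  set T : ℕ → ℝ → ℝ := fun (L : ℕ) (β : ℝ) => max (κ * β + c₀) 1 - q * Real.log (max (κ * β + c₀) 1 + q) -
    2 * b₀ * Real.log ((L : ℝ) / 8) with hT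
  set u : ℕ → ℝ → ℝ := fun (L : ℕ) (β : ℝ) => ((1 + q) * Real.exp (min (T L β) 0) + max (T L β) 0 +
    q * (Real.log (max (T L β) 0 + Real.exp 1) - 1))⁻¹ with hu
  obtain ⟨hax, hpair⟩ := hphys T u hT hu
  obtain ⟨hpos, hcont, hfrz⟩ := stub_twoLoopAdmissible κ c₀ b₀ q hκ hq T u hT hu
  obtain ⟨κ₁, κ₂, hκ₁, hcomp, hstep⟩ := stub_twoLoopStepLaw κ c₀ b₀ q u₀ hb₀ hq hu₀ hu₀ψ T u hT hu
  refine ⟨u, u₀, β₀, κ₁, κ₂, 0, c, C, hu₀, hc, hκ₁, le_rfl, fun L β _ _ => hpos L β,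
    fun L _ => (hcont L).continuousOn, fun L _ => hfrz L, ?_, ?_, hax, hpair⟩
  · intro L L' β _ hL hLL' hL'L hwin
    exact hcomp L L' β hL hLL' hL'L (hwin L hL le_rfl)
  · intro k m β _ hwin
    have h8 : 8 ≤ 8 * 2 ^ (k + m) := Nat.le_mul_of_pos_right 8 (Nat.pow_pos (by norm_num))
    obtain ⟨h1, h2⟩ := hstep k m β (hwin (8 * 2 ^ (k + m)) h8 le_rfl)
    exact ⟨by linarith, by linarith⟩

/-- **Cycle-2 reduction at fixed data**: `AsymptoticScalingAt r → CruxCAt r` (two-loop coupling ⇒ AF coupling ⇒ the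
continuous unit map and the `Γ`-clauses by E-a/E-b). -/
theorem cruxCAt_of_asymptoticScalingAt {G : Type} [Group G] [TopologicalSpace G] [IsTopologicalGroup G]
    [CompactSpace G] [MeasurableSpace G] [BorelSpace G] (r : LatticeRep G) (h : AsymptoticScalingAt r) :
    CruxCAt r :=
  cruxCAt_of_afCouplingAt r (afCouplingAt_of_asymptoticScalingAt r h)

/-- **`AsymptoticScaling → FemtoCurvatureTwoPointC`.** The crux follows from two-sided asymptotic scaling of the curvature
covariances in explicit two-loop units (the registered physics stub of line `Sketch`, v2), by the landed calculus and
real-analysis reductions alone. -/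
theorem femtoCurvatureTwoPointC_of_asymptoticScaling (h : AsymptoticScaling) :
    Summit.QuantumFields.YangMills.Theses.LangevinControlUV.FemtoCurvatureTwoPointC :=
  femtoCurvatureTwoPointC_of_afCoupling fun G _ _ _ _ _ _ hG r =>
    afCouplingAt_of_asymptoticScalingAt r (h G hG r)


/-! ## The ultraviolet corollary: 16204's physics stub contains 9363's open fixed-torus stubs -/

/-- `ψ_q` is non-decreasing (for `q ≥ 0`): the explicit two-loop inverse coupling grows with the RG time. -/
theorem twoLoopPsi_mono {q : ℝ} (hq : 0 ≤ q) : Monotone (twoLoopPsi q) := by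
  intro s t hst
  simp only [twoLoopPsi]
  have h1 : Real.exp (min s 0) ≤ Real.exp (min t 0) := Real.exp_le_exp.mpr (min_le_min_right 0 hst)
  have h2 : max s 0 ≤ max t 0 := max_le_max_right 0 hst
  have h3 : Real.log (max s 0 + Real.exp 1) ≤ Real.log (max t 0 + Real.exp 1) :=
    Real.log_le_log (by positivity) (by linarith)
  have h1q : 0 ≤ 1 + q := by linarith
  nlinarith [mul_le_mul_of_nonneg_left h1 h1q, mul_le_mul_of_nonneg_left h3 hq]

/-- `ψ_q > 0` (for `q ≥ 0`). -/
theorem twoLoopPsi_pos {q : ℝ} (hq : 0 ≤ q) (t : ℝ) : 0 < twoLoopPsi q t := by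
  simp only [twoLoopPsi]
  have h1 : 0 < Real.exp (min t 0) := Real.exp_pos _
  have h2 : 0 ≤ max t 0 := le_max_right _ _
  have h3 : 1 ≤ Real.log (max t 0 + Real.exp 1) :=
    (Real.le_log_iff_exp_le (by positivity)).2 (by linarith)
  nlinarith [mul_pos (by linarith : (0 : ℝ) < 1 + q) h1, mul_le_mul_of_nonneg_left h3 hq]

/-- The two-loop RG time decreases with the box size (`1 ≤ M ≤ L`). -/
theorem twoLoopT_anti (κ c₀ b₀ q : ℝ) (hb₀ : 0 ≤ b₀) (β : ℝ) {M L : ℕ} (hM : 1 ≤ M) (hML : M ≤ L) :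
    twoLoopT κ c₀ b₀ q L β ≤ twoLoopT κ c₀ b₀ q M β := by
  simp only [twoLoopT]
  have hM' : (0 : ℝ) < (M : ℝ) / 8 := by positivity
  have hlog : Real.log ((M : ℝ) / 8) ≤ Real.log ((L : ℝ) / 8) :=
    Real.log_le_log hM' (by gcongr)
  nlinarith [mul_le_mul_of_nonneg_left hlog (by linarith : (0 : ℝ) ≤ 2 * b₀)]

/-- **The explicit two-loop coupling grows with the box size**: `u(M,β) ≤ u(L,β)` for `1 ≤ M ≤ L` (`b₀, q ≥ 0`); in
particular a box is in the `u`-window iff its top box is. -/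
theorem twoLoopCoupling_mono (κ c₀ b₀ q : ℝ) (hb₀ : 0 ≤ b₀) (hq : 0 ≤ q) (β : ℝ) {M L : ℕ} (hM : 1 ≤ M)
    (hML : M ≤ L) : twoLoopCoupling κ c₀ b₀ q M β ≤ twoLoopCoupling κ c₀ b₀ q L β := by
  simp only [twoLoopCoupling]
  exact inv_anti₀ (twoLoopPsi_pos hq _) (twoLoopPsi_mono hq (twoLoopT_anti κ c₀ b₀ q hb₀ β hM hML))

/-- Arithmetic of the transfer, positivity: `c·u² ≤ n⁸·A` with `c, u², n⁸ > 0` forces `A > 0`. -/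
theorem pos_of_transfer (c u2 n8 A : ℝ) (hc : 0 < c) (hu2 : 0 < u2) (hn8 : 0 < n8) (hlow : c * u2 ≤ n8 * A) :
    0 < A := by
  by_contra hA
  push Not at hA
  nlinarith [mul_nonpos_iff.mpr (Or.inl ⟨hn8.le, hA⟩), mul_pos hc hu2]

/-- Arithmetic of the transfer, axis: `c·u² ≤ n⁸A` and `n⁸A' ≤ C·u²` give `A' ≤ max(C/c,1)·A`. -/
theorem axis_transfer (c C u2 n8 A A' : ℝ) (hc : 0 < c) (hu2 : 0 < u2) (hn8 : 0 < n8) (hlow : c * u2 ≤ n8 * A)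
    (hup : n8 * A' ≤ C * u2) : A' ≤ max (C / c) 1 * A := by
  have hA : 0 < A := pos_of_transfer c u2 n8 A hc hu2 hn8 hlow
  have h1 : C * u2 ≤ max (C / c) 1 * (c * u2) := by
    have : C * u2 = C / c * (c * u2) := by field_simp
    rw [this]
    exact mul_le_mul_of_nonneg_right (le_max_left _ _) (by positivity)
  have h2 : max (C / c) 1 * (c * u2) ≤ max (C / c) 1 * (n8 * A) := mul_le_mul_of_nonneg_left hlow (by positivity)
  have h3 : n8 * A' ≤ n8 * (max (C / c) 1 * A) := by nlinarith
  exact le_of_mul_le_mul_left h3 hn8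

/-- Arithmetic of the transfer, pairs: `c·u² ≤ n⁸A`, `0 ≤ v² ≤ u²` and `B·n⁸ ≤ C·v²` give `B ≤ max(C/c,1)·A`. -/
theorem pair_transfer (c C u2 v2 n8 A B : ℝ) (hc : 0 < c) (hu2 : 0 < u2) (hn8 : 0 < n8) (hv : v2 ≤ u2)
    (hv0 : 0 ≤ v2) (hlow : c * u2 ≤ n8 * A) (hp : B * n8 ≤ C * v2) : B ≤ max (C / c) 1 * A := by
  have hA : 0 < A := pos_of_transfer c u2 n8 A hc hu2 hn8 hlow
  have hM : 1 ≤ max (C / c) 1 := le_max_right _ _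
  rcases le_or_gt 0 C with hC | hC
  · have h1 : C * v2 ≤ C * u2 := mul_le_mul_of_nonneg_left hv hC
    have h2 : C * u2 ≤ max (C / c) 1 * (c * u2) := by
      have : C * u2 = C / c * (c * u2) := by field_simp
      rw [this]
      exact mul_le_mul_of_nonneg_right (le_max_left _ _) (by positivity)
    have h3 : max (C / c) 1 * (c * u2) ≤ max (C / c) 1 * (n8 * A) :=
      mul_le_mul_of_nonneg_left hlow (by positivity)
    have h4 : n8 * B ≤ n8 * (max (C / c) 1 * A) := by nlinarith
    exact le_of_mul_le_mul_left h4 hn8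
  · have h1 : C * v2 ≤ 0 := by nlinarith
    have h2 : 0 < n8 * (max (C / c) 1 * A) := by positivity
    have h4 : n8 * B ≤ n8 * (max (C / c) 1 * A) := by nlinarith
    exact le_of_mul_le_mul_left h4 hn8

/-- **Ultraviolet corollary — asymptotic scaling contains the eventual shape-free bounds of crux 9363.** At fixed data
`(G, r)`, `AsymptoticScalingAt r` implies the hypothesis `H` of `FemtoCurvatureTwoPoint.RateFree.cruxAt_of_shapeFree`
(positivity of the reference axis covariance, cross-torus comparability and pair domination, EVENTUALLY in `β` for tori of
bounded size — the open fixed-torus stubs `stub_crossTorus` / `stub_pairDomination` of line `generic-step-gamma-encoding`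
of the predecessor crux stmt-QuantumFields-9363): every bounded family of boxes is eventually inside the two-loop window
(`u(L₀,β) → 0`), where two-sided matching gives all three with `K = C/c`. So ONE physics statement serves both cruxes. -/
theorem shapeFree_of_asymptoticScalingAt {G : Type} [Group G] [TopologicalSpace G] [IsTopologicalGroup G]
    [CompactSpace G] [MeasurableSpace G] [BorelSpace G] (r : LatticeRep G) (h : AsymptoticScalingAt r) :
    ∃ K : ℝ, 0 < K ∧ ∀ L₀ : ℕ, ∃ T : ℝ, ∀ β : ℝ, T ≤ β → ∀ (L L' : ℕ) [NeZero L] [NeZero L'] (n : ℕ), 1 ≤ n → 8 * n ≤ L → L ≤ L₀ → L' ≤ L₀ → 0 < wilsonExpectation r.ρ β (fun U : GaugeConfig 4 L G => ((r.N : ℝ) - (r.ρ (plaquetteHolonomy U 0 0 1)).trace.re) * ((r.N : ℝ) - (r.ρ (plaquetteHolonomy U (Pi.single (2 : Fin 4) ((n : ℕ) : ZMod L)) 0 1)).trace.re)) - wilsonExpectation r.ρ β (fun U : GaugeConfig 4 L G => (r.N : ℝ) - (r.ρ (plaquetteHolonomy U 0 0 1)).trace.re) * wilsonExpectation r.ρ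 β (fun U : GaugeConfig 4 L G => (r.N : ℝ) - (r.ρ (plaquetteHolonomy U (Pi.single (2 : Fin 4) ((n : ℕ) : ZMod L)) 0 1)).trace.re) ∧ (8 * n ≤ L' → wilsonExpectation r.ρ β (fun U : GaugeConfig 4 L' G => ((r.N : ℝ) - (r.ρ (plaquetteHolonomy U 0 0 1)).trace.re) * ((r.N : ℝ) - (r.ρ (plaquetteHolonomy U (Pi.single (2 : Fin 4) ((n : ℕ) : ZMod L')) 0 1)).trace.re)) - wilsonExpectation r.ρ β (fun U : GaugeConfig 4 L' G => (r.N : ℝ) - (r.ρ (plaquetteHolonomy U 0 0 1)).trace.re) * wilsonExpectation r.ρ β (fun U : GaugeConfig 4 L' G => (r.N : ℝ) - (r.ρ (plaquetteHolonomy U (Pi.single (2 : Fin 4) ((n : ℕ) : ZMod L')) 0 1)).trace.re) ≤ K * (wilsonExpectation r.ρ β (fun U : GaugeConfig 4 L G => ((r.N : ℝ) - (r.ρ (plaquetteHolonomy U 0 0 1)).trace.re) * ((r.N : ℝ) - (r.ρ (plaquetteHolonomy U (Pi.single (2 : Fin 4) ((n : ℕ) : ZMod L)) 0 1)).trace.re))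 - wilsonExpectation r.ρ β (fun U : GaugeConfig 4 L G => (r.N : ℝ) - (r.ρ (plaquetteHolonomy U 0 0 1)).trace.re) * wilsonExpectation r.ρ β (fun U : GaugeConfig 4 L G => (r.N : ℝ) - (r.ρ (plaquetteHolonomy U (Pi.single (2 : Fin 4) ((n : ℕ) : ZMod L)) 0 1)).trace.re))) ∧ ∀ (x y : Fin 4 → ZMod L') (i j i' j' : Fin 4), x ≠ y → i ≠ j → i' ≠ j' → Real.sqrt (∑ k : Fin 4, (((x k - y k).valMinAbs : ℤ) : ℝ) ^ 2) = n → |wilsonExpectation r.ρ β (fun U : GaugeConfig 4 L' G => ((r.N : ℝ) - (r.ρ (plaquetteHolonomy U x i j)).trace.re) * ((r.N : ℝ) - (r.ρ (plaquetteHolonomy U y i' j')).trace.re)) - wilsonExpectation r.ρ β (fun U : GaugeConfig 4 L' G => (r.N : ℝ) - (r.ρ (plaquetteHolonomy U x i j)).trace.re) * wilsonExpectation r.ρ β (fun U : GaugeConfig 4 L' G => (r.N : ℝ) - (r.ρ (plaquetteHolonomy U y i' j')).trace.re)| ≤ K * (wilsonExpectation r.ρ β (fun U : GaugeConfig 4 L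 G => ((r.N : ℝ) - (r.ρ (plaquetteHolonomy U 0 0 1)).trace.re) * ((r.N : ℝ) - (r.ρ (plaquetteHolonomy U (Pi.single (2 : Fin 4) ((n : ℕ) : ZMod L)) 0 1)).trace.re)) - wilsonExpectation r.ρ β (fun U : GaugeConfig 4 L G => (r.N : ℝ) - (r.ρ (plaquetteHolonomy U 0 0 1)).trace.re) * wilsonExpectation r.ρ β (fun U : GaugeConfig 4 L G => (r.N : ℝ) - (r.ρ (plaquetteHolonomy U (Pi.single (2 : Fin 4) ((n : ℕ) : ZMod L)) 0 1)).trace.re)) := by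
  obtain ⟨κ, c₀, b₀, q, u₀, β₀, c, C, hκ, hb₀, hq, hu₀, hu₀ψ, hc, hphys⟩ := h
  obtain ⟨hax, hpair⟩ := hphys (twoLoopT κ c₀ b₀ q) (twoLoopCoupling κ c₀ b₀ q) (twoLoopT_eq κ c₀ b₀ q)
    (twoLoopCoupling_eq κ c₀ b₀ q)
  obtain ⟨hpos, -, hfrz⟩ := stub_twoLoopAdmissible κ c₀ b₀ q hκ hq (twoLoopT κ c₀ b₀ q)
    (twoLoopCoupling κ c₀ b₀ q) (twoLoopT_eq κ c₀ b₀ q) (twoLoopCoupling_eq κ c₀ b₀ q)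
  set u := twoLoopCoupling κ c₀ b₀ q with hu
  refine ⟨max (C / c) 1, lt_max_of_lt_right one_pos, fun L₀ => ?_⟩
  -- eventually `β ≥ β₀` and the box `max L₀ 8` (hence every box `≤ L₀`) is in the window
  have hev : ∀ᶠ β in atTop, β₀ ≤ β ∧ u (max L₀ 8) β ≤ u₀ :=
    (eventually_ge_atTop β₀).and ((hfrz (max L₀ 8)).eventually (eventually_le_nhds hu₀))
  obtain ⟨T, hT⟩ := Filter.eventually_atTop.mp hev
  refine ⟨T, fun β hβ L L' _ _ n hn hnL hLL₀ hL'L₀ => ?_⟩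
  obtain ⟨hβ₀, htop⟩ := hT β hβ
  have hwin : ∀ {N : ℕ}, N ≤ L₀ → ∀ M : ℕ, 8 ≤ M → M ≤ N → u M β ≤ u₀ := fun hN M hM hMN =>
    (twoLoopCoupling_mono κ c₀ b₀ q hb₀.le hq β (by omega) (by omega : M ≤ max L₀ 8)).trans htop
  have hnpos : (0 : ℝ) < (n : ℝ) ^ 8 := by positivity
  have hu2 : 0 < u (8 * n) β ^ 2 := pow_pos (hpos _ _) 2
  obtain ⟨hlow, -⟩ := hax L β n hβ₀ hn hnL (hwin hLL₀) _ _ rfl rfl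
  have hApos := pos_of_transfer c (u (8 * n) β ^ 2) _ _ hc hu2 hnpos hlow
  refine ⟨hApos, fun hnL' => ?_, fun x y i j i' j' hxy hij hij' hd => ?_⟩
  · obtain ⟨-, hup⟩ := hax L' β n hβ₀ hn hnL' (hwin hL'L₀) _ _ rfl rfl
    exact axis_transfer c C (u (8 * n) β ^ 2) _ _ _ hc hu2 hnpos hlow hup
  · have hp := hpair L' β hβ₀ (hwin hL'L₀) _ _ rfl rfl x y i j i' j' hxy hij hij'
    rw [hd, Nat.ceil_natCast] at hp
    have hbox : u (max 8 (min L' (8 * n))) β ≤ u (8 * n) β :=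
      twoLoopCoupling_mono κ c₀ b₀ q hb₀.le hq β (by omega) (by omega)
    exact pair_transfer c C (u (8 * n) β ^ 2) (u (max 8 (min L' (8 * n))) β ^ 2) _ _ _ hc hu2 hnpos
      (pow_le_pow_left₀ (hpos _ _).le hbox 2) (sq_nonneg _) hlow hp

/-- **Corollary — the predecessor crux from asymptotic scaling, directly through its own rate-free line**:
`AsymptoticScalingAt r → FemtoCurvatureTwoPoint.CruxAt r` (stmt-QuantumFields-9363 at fixed data), by
`shapeFree_of_asymptoticScalingAt` and the landed `RateFree.cruxAt_of_shapeFree`. (Also implied through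
`FemtoCurvatureTwoPointC → FemtoCurvatureTwoPoint`, `…TwoPointOfC`; this route records that 9363's open fixed-torus stubs
are the ultraviolet end of 16204's physics stub.) -/
theorem femtoCurvatureTwoPoint_cruxAt_of_asymptoticScalingAt {G : Type} [Group G] [TopologicalSpace G]
    [IsTopologicalGroup G] [CompactSpace G] [MeasurableSpace G] [BorelSpace G] (r : LatticeRep G)
    (h : AsymptoticScalingAt r) :
    Summit.QuantumFields.YangMills.Cruxes.FemtoCurvatureTwoPoint.GenericStepGammaEncoding.CruxAt r :=
  FemtoCurvatureTwoPoint.RateFree.cruxAt_of_shapeFree r (shapeFree_of_asymptoticScalingAt r h)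


/-! ## The window of the explicit coupling is the femto condition -/

/-- `ψ_q` is strictly increasing (for `q ≥ 0`). -/
theorem twoLoopPsi_strictMono {q : ℝ} (hq : 0 ≤ q) : StrictMono (twoLoopPsi q) := by
  intro s t hst
  simp only [twoLoopPsi]
  have h1 : Real.exp (min s 0) ≤ Real.exp (min t 0) := Real.exp_le_exp.mpr (min_le_min_right 0 hst.le)
  have h2 : max s 0 ≤ max t 0 := max_le_max_right 0 hst.le
  have h3 : Real.log (max s 0 + Real.exp 1) ≤ Real.log (max t 0 + Real.exp 1) :=
    Real.log_le_log (by positivity) (by linarith)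
  have h1q : 0 < 1 + q := by linarith
  rcases lt_or_ge (min s 0) (min t 0) with hlt | hge
  · have he : Real.exp (min s 0) < Real.exp (min t 0) := Real.exp_lt_exp.mpr hlt
    nlinarith [mul_lt_mul_of_pos_left he h1q, mul_le_mul_of_nonneg_left h3 hq]
  · have hmax : max s 0 < max t 0 := by
      have hs := min_add_max s 0
      have ht := min_add_max t 0
      simp only [add_zero] at hs ht
      have hle : min s 0 ≤ min t 0 := min_le_min_right 0 hst.le
      linarith
    nlinarith [mul_le_mul_of_nonneg_left h1 h1q.le, mul_le_mul_of_nonneg_left h3 hq]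

/-- **Window ⟺ top box**: for the explicit coupling the window hypothesis of `AFCouplingAt` / `AsymptoticScalingAt`
("every sub-box `8 ≤ M ≤ L` has `u M β ≤ u₀`") is just `u L β ≤ u₀` (`L ≥ 8`). -/
theorem twoLoop_window_iff (κ c₀ b₀ q : ℝ) (hb₀ : 0 ≤ b₀) (hq : 0 ≤ q) {L : ℕ} (hL : 8 ≤ L) (β u₀ : ℝ) :
    (∀ M : ℕ, 8 ≤ M → M ≤ L → twoLoopCoupling κ c₀ b₀ q M β ≤ u₀) ↔ twoLoopCoupling κ c₀ b₀ q L β ≤ u₀ :=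
  ⟨fun h => h L hL le_rfl, fun h M hM hML => (twoLoopCoupling_mono κ c₀ b₀ q hb₀ hq β (by omega) hML).trans h⟩

/-- **The window threshold**: under the smallness condition `u₀·ψ_q(2b₀ log 2) < 1` of the stubs there is an RG time
`T₀ > 2b₀ log 2` with `ψ_q(T₀) = 1/u₀` (intermediate value theorem: `ψ_q` is continuous and `→ ∞`; it is unique by
`twoLoopPsi_strictMono`). -/
theorem exists_windowThreshold {b₀ q u₀ : ℝ} (hb₀ : 0 < b₀) (hq : 0 ≤ q) (hu₀ : 0 < u₀)
    (hu₀ψ : u₀ * (1 + 2 * b₀ * Real.log 2 + q * Real.log (2 * b₀ * Real.log 2 + Real.exp 1)) < 1) :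
    ∃ T₀ : ℝ, 2 * b₀ * Real.log 2 < T₀ ∧ twoLoopPsi q T₀ = u₀⁻¹ := by
  have ht₁0 : (0 : ℝ) ≤ 2 * b₀ * Real.log 2 := by positivity
  have hψt₁ : twoLoopPsi q (2 * b₀ * Real.log 2) =
      1 + 2 * b₀ * Real.log 2 + q * Real.log (2 * b₀ * Real.log 2 + Real.exp 1) := by
    rw [twoLoopPsi, min_eq_right ht₁0, max_eq_left ht₁0, Real.exp_zero]
    ring
  have hlt : twoLoopPsi q (2 * b₀ * Real.log 2) < u₀⁻¹ := by
    have h' : u₀ * twoLoopPsi q (2 * b₀ * Real.log 2) < u₀ * u₀⁻¹ := by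
      rw [mul_inv_cancel₀ hu₀.ne', hψt₁]
      exact hu₀ψ
    exact lt_of_mul_lt_mul_left h' hu₀.le
  have hcont : Continuous (twoLoopPsi q) := twoLoopAdm_psi_continuous q
  have htend : Tendsto (twoLoopPsi q) atTop atTop := twoLoopAdm_psi_tendsto_atTop q hq
  obtain ⟨t₂, ht₂⟩ := ((htend.eventually_ge_atTop u₀⁻¹).and (eventually_ge_atTop (2 * b₀ * Real.log 2))).exists
  obtain ⟨hψt₂, ht₁t₂⟩ := ht₂
  obtain ⟨T₀, hT₀mem, hT₀⟩ :=
    intermediate_value_Icc ht₁t₂ hcont.continuousOn ⟨hlt.le, hψt₂⟩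
  refine ⟨T₀, lt_of_le_of_ne hT₀mem.1 ?_, hT₀⟩
  rintro rfl
  exact hlt.ne hT₀

/-- **Window ⟺ RG time above the threshold**: `u L β ≤ u₀ ↔ T₀ ≤ T(L,β)` when `ψ_q(T₀) = 1/u₀`. -/
theorem twoLoop_top_iff (κ c₀ b₀ q : ℝ) (hq : 0 ≤ q) {T₀ u₀ : ℝ} (hu₀ : 0 < u₀) (hT₀ : twoLoopPsi q T₀ = u₀⁻¹)
    (L : ℕ) (β : ℝ) : twoLoopCoupling κ c₀ b₀ q L β ≤ u₀ ↔ T₀ ≤ twoLoopT κ c₀ b₀ q L β := by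
  simp only [twoLoopCoupling]
  rw [inv_le_comm₀ (twoLoopPsi_pos hq _) hu₀, ← hT₀]
  exact (twoLoopPsi_strictMono hq).le_iff_le

/-- **Window ⟺ femto condition**: `T₀ ≤ T(L,β) ↔ L ≤ 8·exp((Y(β) − T₀)/(2b₀))` with
`Y(β) = max(κβ+c₀,1) − q·log(max(κβ+c₀,1) + q)` — i.e. `L ≤ ℓ·a₂ₗₒₒₚ(β)⁻¹` with the two-loop unit
`a₂ₗₒₒₚ(β) ∝ exp(−Y(β)/(2b₀))` (`L ≥ 1`, `b₀ > 0`). -/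
theorem twoLoopT_ge_iff (κ c₀ b₀ q : ℝ) (hb₀ : 0 < b₀) {L : ℕ} (hL : 1 ≤ L) (β T₀ : ℝ) :
    T₀ ≤ twoLoopT κ c₀ b₀ q L β ↔
      (L : ℝ) ≤ 8 * Real.exp ((max (κ * β + c₀) 1 - q * Real.log (max (κ * β + c₀) 1 + q) - T₀) / (2 * b₀)) := by
  simp only [twoLoopT]
  have hL8 : (0 : ℝ) < (L : ℝ) / 8 := by positivity
  have h2b : (0 : ℝ) < 2 * b₀ := by positivity
  rw [← div_le_iff₀' (by norm_num : (0 : ℝ) < 8), ← Real.log_le_iff_le_exp hL8, le_div_iff₀ h2b]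
  constructor <;> intro h <;> linarith

/-- **The window of `AsymptoticScalingAt`, unfolded**: for `L ≥ 8`, every sub-box `8 ≤ M ≤ L` has `u M β ≤ u₀` iff
`L ≤ 8·exp((Y(β) − T₀)/(2b₀))`, where `T₀` is the window threshold (`ψ_q(T₀) = 1/u₀`). -/
theorem twoLoop_window_iff_femto (κ c₀ b₀ q : ℝ) (hb₀ : 0 < b₀) (hq : 0 ≤ q) {T₀ u₀ : ℝ} (hu₀ : 0 < u₀)
    (hT₀ : twoLoopPsi q T₀ = u₀⁻¹) {L : ℕ} (hL : 8 ≤ L) (β : ℝ) :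
    (∀ M : ℕ, 8 ≤ M → M ≤ L → twoLoopCoupling κ c₀ b₀ q M β ≤ u₀) ↔
      (L : ℝ) ≤ 8 * Real.exp ((max (κ * β + c₀) 1 - q * Real.log (max (κ * β + c₀) 1 + q) - T₀) / (2 * b₀)) := by
  rw [twoLoop_window_iff κ c₀ b₀ q hb₀.le hq hL, twoLoop_top_iff κ c₀ b₀ q hq hu₀ hT₀,
    twoLoopT_ge_iff κ c₀ b₀ q hb₀ (by omega)]


/-! ## Cycle 3 (continuation lead `prover-line-stmt-QuantumFields-16204-c1-0`): the universal closure
`AsymptoticScaling → AFCoupling` by name — the bridge a line on the promoted item `AFCoupling` imports -/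

/-- **`AsymptoticScaling → AFCoupling`** (universal closure of `afCouplingAt_of_asymptoticScalingAt`): the explicit two-loop
asymptotic-freedom coupling is, for every compact simple `G` and faithful `r`, an admissible coupling with the
asymptotic-freedom step law matched to the curvature two-point function. Skeleton v3 of line `Sketch`
(`Cruxes/FemtoCurvatureTwoPointC/Lines/Sketch.lean`) registers `AFCoupling` (= `stub_afCoupling`, `afCoupling_iff_stub`) as
the crux's single open stub — the weakest statement closing the crux through `femtoCurvatureTwoPointC_of_afCoupling` — and
this theorem records v2's explicit witness `AsymptoticScaling` as one sufficient (stronger, loop-exact) route to it. -/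
theorem afCoupling_of_asymptoticScaling (h : AsymptoticScaling) : AFCoupling :=
  fun G _ _ _ _ _ _ hG r => afCouplingAt_of_asymptoticScalingAt r (h G hG r)

end Summit.QuantumFields.YangMills.Theorems.FemtoCurvatureTwoPointC

end
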